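import Summits.ValiantsHypothesis.ValiantsHypothesis.Theorems.BarrierLeverAnchoredDoorHitsLowerPairsStubGenericPoint
import Summits.ValiantsHypothesis.ValiantsHypothesis.Theorems.BarrierLeverPartitionMinorsHitByVPBlockProducts

/-!
# Support item `AnchoredDoorHitsLowerPairs` (stmt-ValiantsHypothesis-22510), line `anchored-peeling`:
# symbolic non-vanishing of the anchored door is CLOSED UNDER BLOCK PRODUCTS (joins)

Helper file (`--supports stmt-ValiantsHypothesis-22510`; cell valiant-natproofs, rung V4, 𝒟-side door (c); prover seat
val-np-p1 gen 16). Closes NO item.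

`symbolicDet_blockProduct_ne_zero`: split the `x`-vertices by a block `B` and the `y`-vertices by a block `C`. If the layout
`(u, w)` factors as `u i = u₁ (er i).1 ∪ u₂ (er i).2`, `w j = w₁ (ec j).1 ∪ w₂ (ec j).2` through bijections
`er, ec : Fin r ≃ Fin r₁ × Fin r₂`, with `u₁ ⊆ B`, `w₁ ⊆ C`, `u₂ ⊆ Bᶜ`, `w₂ ⊆ Cᶜ`, and both factor layouts have nonzero
symbolic minor (`symbolicDet s h r₁ u₁ w₁ ≠ 0`, `symbolicDet s h r₂ u₂ w₂ ≠ 0`), then `symbolicDet s h r u w ≠ 0`.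
In particular the JOIN `(K ∗ L, K' ∗ L')` of two pairs on disjoint vertex blocks is hit by 𝔄_s as soon as `(K, K')` and
`(L, L')` are — so the families certified on the line (cube-vs-ball, `…CubeBall`; `(∂Δⁿ, Δⁿ⁻¹ ⊔ Δⁿ⁻¹)`, `…SimplexBoundary`;
the thin sides, `…ThinSide`) generate further certified pairs, among them new RIGID ones (e.g. `P_n ∗ P_m`: star counts
multiply, odd times odd against powers of two), and a rigid pair that is a block product reduces to its factors.

PROOF. Take hit points `p₁, p₂` of the factors (`stub_genericPoint`); KILL every variable outside block 1 in the member at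
`p₁` (`kill`, the substitution `X_v ↦ 0` off the block; `coeff_kill`: coefficients of block monomials are unchanged, so the
factor layout keeps its nonzero determinant; `support_kill`: the result lives on block variables) and likewise for block 2;
the member of 𝔄_s at the GLUED point (block-1 anchors carry `p₁` with tails cut to block 1, block-2 anchors carry `p₂`, all
other anchors weight `0`) is exactly the product of the two killed members (`anchoredWitness_glue`), and val-np-p6's
block-product door (`BlockProduct.partitionMinor_hit_of_blockProduct_fin`: Kronecker product, `Matrix.det_kronecker`) gives
the nonzero minor; `symbolicDet_ne_zero_of_hit` transfers it to the symbolic minor.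

WHAT THIS IS NOT: a closure property; nothing on which pairs are hit, on item 19717, on crux stmt-ValiantsHypothesis-14610,
or on `VP` versus `VNP`.
-/

set_option linter.dupNamespace false

namespace Summit.ValiantsHypothesis.ValiantsHypothesis.Theorems.BarrierLever.AnchoredPeeling

open Finset MvPolynomial

noncomputable section

namespace BlockGlue

variable {h : ℕ}

/-! ## 1. Killing the variables outside a set -/

/-- The substitution killing every variable outside `V`. -/
def kill (V : Finset (Fin (h + h))) : MvPolynomial (Fin (h + h)) ℂ →ₐ[ℂ] MvPolynomial (Fin (h + h)) ℂ :=
  bind₁ fun v => if v ∈ V then X v else 0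

/-- `kill` on a variable. -/
theorem kill_X (V : Finset (Fin (h + h))) (v : Fin (h + h)) :
    kill V (X v : MvPolynomial (Fin (h + h)) ℂ) = if v ∈ V then X v else 0 := by
  rw [kill, bind₁_X_right]

/-- `kill` on a monomial: kept iff supported inside `V`. -/
theorem kill_monomial (V : Finset (Fin (h + h))) (d : Fin (h + h) →₀ ℕ) (r : ℂ) :
    kill V (monomial d r) = if d.support ⊆ V then monomial d r else 0 := by
  classical
  rw [kill, bind₁_monomial]
  by_cases hd : d.support ⊆ V
  · rw [if_pos hd, monomial_eq, Finsupp.prod]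
    congr 1
    exact Finset.prod_congr rfl (fun i hi => by rw [if_pos (hd hi)])
  · rw [if_neg hd]
    obtain ⟨i, hi, hiV⟩ := Finset.not_subset.mp hd
    rw [Finset.prod_eq_zero hi, mul_zero]
    rw [if_neg hiV, zero_pow (Finsupp.mem_support_iff.mp hi)]

/-- Coefficients after killing: block monomials keep their coefficient, the others vanish. -/
theorem coeff_kill (V : Finset (Fin (h + h))) (f : MvPolynomial (Fin (h + h)) ℂ) (m : Fin (h + h) →₀ ℕ) :
    coeff m (kill V f) = if m.support ⊆ V then coeff m f else 0 := by
  classical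
  conv_lhs => rw [f.as_sum, map_sum, coeff_sum]
  simp_rw [kill_monomial]
  have hterm : ∀ d ∈ f.support, coeff m (if d.support ⊆ V then monomial d (coeff d f) else 0) =
      if d = m then (if m.support ⊆ V then coeff m f else 0) else 0 := by
    intro d _
    by_cases hdm : d = m
    · subst hdm
      by_cases hV : d.support ⊆ V
      · rw [if_pos hV, if_pos rfl, if_pos hV, coeff_monomial, if_pos rfl]
      · rw [if_neg hV, if_pos rfl, if_neg hV, coeff_zero]
    · rw [if_neg hdm]
      by_cases hV : d.support ⊆ V
      · rw [if_pos hV, coeff_monomial, if_neg hdm]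
      · rw [if_neg hV, coeff_zero]
  rw [Finset.sum_congr rfl hterm, Finset.sum_ite_eq' f.support m]
  by_cases hm : m ∈ f.support
  · rw [if_pos hm]
  · rw [if_neg hm]
    by_cases hV : m.support ⊆ V
    · rw [if_pos hV, notMem_support_iff.mp hm]
    · rw [if_neg hV]

/-- The killed polynomial lives on the variables of `V`. -/
theorem support_kill (V : Finset (Fin (h + h))) (f : MvPolynomial (Fin (h + h)) ℂ) :
    ∀ d ∈ (kill V f).support, d.support ⊆ V := by
  intro d hd
  by_contra hV
  rw [mem_support_iff, coeff_kill, if_neg hV] at hd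
  exact hd rfl

/-! ## 2. Block variables and block anchors -/

/-- The variables of the block `(B | C)`: the `x_a`, `a ∈ B`, and the `y_c`, `c ∈ C`. -/
def bvars (B D : Finset (Fin h)) : Finset (Fin (h + h)) := B.map (Fin.castAddEmb h) ∪ D.map (Fin.natAddEmb h)

/-- `x_a` is a block variable iff `a ∈ B`. -/
theorem castAdd_mem_bvars (B D : Finset (Fin h)) (a : Fin h) : Fin.castAdd h a ∈ bvars B D ↔ a ∈ B := by
  rw [bvars, Finset.mem_union]
  constructor
  · rintro (ha | hc)
    · obtain ⟨a', ha', he⟩ := Finset.mem_map.mp ha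
      have : a' = a := by
        have := congrArg Fin.val he; simp [Fin.castAddEmb] at this; exact Fin.ext this
      exact this ▸ ha'
    · obtain ⟨c, -, hc'⟩ := Finset.mem_map.mp hc
      have := congrArg Fin.val hc'
      simp [Fin.natAddEmb] at this
      omega
  · intro ha
    exact Or.inl (Finset.mem_map.mpr ⟨a, ha, rfl⟩)

/-- `y_c` is a block variable iff `c ∈ C`. -/
theorem natAdd_mem_bvars (B D : Finset (Fin h)) (c : Fin h) : Fin.natAdd h c ∈ bvars B D ↔ c ∈ D := by
  rw [bvars, Finset.mem_union]
  constructor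
  · rintro (ha | hc)
    · obtain ⟨a, -, ha'⟩ := Finset.mem_map.mp ha
      have := congrArg Fin.val ha'
      simp [Fin.castAddEmb] at this
      omega
    · obtain ⟨c', hc', he⟩ := Finset.mem_map.mp hc
      have : c' = c := by
        have := congrArg Fin.val he; simp [Fin.natAddEmb] at this; exact Fin.ext this
      exact this ▸ hc'
  · intro hc
    exact Or.inr (Finset.mem_map.mpr ⟨c, hc, rfl⟩)

/-- Killing a product of `x`-variables: kept iff inside the block. -/
theorem kill_prod_X_castAdd (B D A : Finset (Fin h)) :
    kill (bvars B D) (∏ a ∈ A, X (Fin.castAdd h a) : MvPolynomial (Fin (h + h)) ℂ) =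
      if A ⊆ B then ∏ a ∈ A, X (Fin.castAdd h a) else 0 := by
  classical
  rw [map_prod]
  simp_rw [kill_X, castAdd_mem_bvars]
  by_cases hA : A ⊆ B
  · rw [if_pos hA]; exact Finset.prod_congr rfl (fun a ha => by rw [if_pos (hA ha)])
  · rw [if_neg hA]
    obtain ⟨a, ha, haB⟩ := Finset.not_subset.mp hA
    exact Finset.prod_eq_zero ha (by rw [if_neg haB])

/-- Killing a product of `y`-variables: kept iff inside the block. -/
theorem kill_prod_X_natAdd (B D A : Finset (Fin h)) :
    kill (bvars B D) (∏ c ∈ A, X (Fin.natAdd h c) : MvPolynomial (Fin (h + h)) ℂ) =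
      if A ⊆ D then ∏ c ∈ A, X (Fin.natAdd h c) else 0 := by
  classical
  rw [map_prod]
  simp_rw [kill_X, natAdd_mem_bvars]
  by_cases hA : A ⊆ D
  · rw [if_pos hA]; exact Finset.prod_congr rfl (fun a ha => by rw [if_pos (hA ha)])
  · rw [if_neg hA]
    obtain ⟨a, ha, haB⟩ := Finset.not_subset.mp hA
    exact Finset.prod_eq_zero ha (by rw [if_neg haB])

/-- Killing an `x`-tail product cuts the tails to the block. -/
theorem kill_prod_xtail (B D E : Finset (Fin h)) (φv : Fin h → ℂ) :
    kill (bvars B D) (∏ b ∈ E, (1 + C (φv b) * X (Fin.castAdd h b)) : MvPolynomial (Fin (h + h)) ℂ) =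
      ∏ b ∈ E, (1 + C (if b ∈ B then φv b else 0) * X (Fin.castAdd h b)) := by
  rw [map_prod]
  refine Finset.prod_congr rfl (fun b _ => ?_)
  rw [map_add, map_one, map_mul, kill, bind₁_C_right, ← kill, kill_X]
  by_cases hb : b ∈ B
  · rw [if_pos ((castAdd_mem_bvars B D b).mpr hb), if_pos hb]
  · rw [if_neg (fun hm => hb ((castAdd_mem_bvars B D b).mp hm)), if_neg hb, mul_zero, map_zero, zero_mul]

/-- Killing a `y`-tail product cuts the tails to the block. -/
theorem kill_prod_ytail (B D E : Finset (Fin h)) (ψv : Fin h → ℂ) :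
    kill (bvars B D) (∏ d ∈ E, (1 + C (ψv d) * X (Fin.natAdd h d)) : MvPolynomial (Fin (h + h)) ℂ) =
      ∏ d ∈ E, (1 + C (if d ∈ D then ψv d else 0) * X (Fin.natAdd h d)) := by
  rw [map_prod]
  refine Finset.prod_congr rfl (fun d _ => ?_)
  rw [map_add, map_one, map_mul, kill, bind₁_C_right, ← kill, kill_X]
  by_cases hd : d ∈ D
  · rw [if_pos ((natAdd_mem_bvars B D d).mpr hd), if_pos hd]
  · rw [if_neg (fun hm => hd ((natAdd_mem_bvars B D d).mp hm)), if_neg hd, mul_zero, map_zero, zero_mul]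

/-- The anchor factor of 𝔄_s with explicit values. -/
def factor (α : Finset (Fin h) × Finset (Fin h)) (t : ℂ) (φv ψv : Fin h → ℂ) : MvPolynomial (Fin (h + h)) ℂ :=
  1 + C t * (∏ a ∈ α.1, X (Fin.castAdd h a)) * (∏ c ∈ α.2, X (Fin.natAdd h c)) *
    (∏ b ∈ univ \ α.1, (1 + C (φv b) * X (Fin.castAdd h b))) *
    (∏ d ∈ univ \ α.2, (1 + C (ψv d) * X (Fin.natAdd h d)))

/-- `anchoredWitness` is the product of the anchor factors. -/
theorem anchoredWitness_eq_prod_factor (s h : ℕ) (θ : Finset (Fin h) × Finset (Fin h) → ℂ)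
    (φ ψ : Finset (Fin h) × Finset (Fin h) → Fin h → ℂ) :
    anchoredWitness s h θ φ ψ = ∏ α ∈ anchors s h, factor α (θ α) (φ α) (ψ α) := rfl

/-- **Killing an anchor factor**: a block anchor keeps its factor with tails cut to the block; any other anchor's factor
becomes `1`. -/
theorem kill_factor (B D : Finset (Fin h)) (α : Finset (Fin h) × Finset (Fin h)) (t : ℂ) (φv ψv : Fin h → ℂ) :
    kill (bvars B D) (factor α t φv ψv) =
      if α.1 ⊆ B ∧ α.2 ⊆ D then factor α t (fun b => if b ∈ B then φv b else 0) (fun d => if d ∈ D then ψv d else 0)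
      else 1 := by
  rw [factor, map_add, map_one, map_mul, map_mul, map_mul, map_mul, kill, bind₁_C_right, ← kill, kill_prod_X_castAdd,
    kill_prod_X_natAdd, kill_prod_xtail, kill_prod_ytail]
  by_cases hα : α.1 ⊆ B ∧ α.2 ⊆ D
  · rw [if_pos hα.1, if_pos hα.2, if_pos hα, factor]
  · rw [if_neg hα]
    rcases not_and_or.mp hα with h1 | h2
    · rw [if_neg h1, mul_zero, zero_mul, zero_mul, zero_mul, add_zero]
    · rw [if_neg h2, mul_zero, zero_mul, zero_mul, add_zero]

/-! ## 3. The glued point -/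

/-- Glued anchor weights: block-1 anchors from `θ₁`, block-2 anchors from `θ₂`, all others `0`. -/
def glueθ (B D : Finset (Fin h)) (θ₁ θ₂ : Finset (Fin h) × Finset (Fin h) → ℂ) :
    Finset (Fin h) × Finset (Fin h) → ℂ := fun α =>
  if α.1 ⊆ B ∧ α.2 ⊆ D then θ₁ α else if α.1 ⊆ Bᶜ ∧ α.2 ⊆ Dᶜ then θ₂ α else 0

/-- Glued `x`-tails, cut to the anchor's own block. -/
def glueφ (B D : Finset (Fin h)) (φ₁ φ₂ : Finset (Fin h) × Finset (Fin h) → Fin h → ℂ) :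
    Finset (Fin h) × Finset (Fin h) → Fin h → ℂ := fun α b =>
  if α.1 ⊆ B ∧ α.2 ⊆ D then (if b ∈ B then φ₁ α b else 0)
  else if α.1 ⊆ Bᶜ ∧ α.2 ⊆ Dᶜ then (if b ∈ Bᶜ then φ₂ α b else 0) else 0

/-- Glued `y`-tails, cut to the anchor's own block. -/
def glueψ (B D : Finset (Fin h)) (ψ₁ ψ₂ : Finset (Fin h) × Finset (Fin h) → Fin h → ℂ) :
    Finset (Fin h) × Finset (Fin h) → Fin h → ℂ := fun α d =>
  if α.1 ⊆ B ∧ α.2 ⊆ D then (if d ∈ D then ψ₁ α d else 0)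
  else if α.1 ⊆ Bᶜ ∧ α.2 ⊆ Dᶜ then (if d ∈ Dᶜ then ψ₂ α d else 0) else 0

/-- An anchor (nonempty `x`-part) cannot lie in both blocks. -/
theorem not_both_blocks {s : ℕ} {B D : Finset (Fin h)} {α : Finset (Fin h) × Finset (Fin h)} (hα : α ∈ anchors s h)
    (h1 : α.1 ⊆ B ∧ α.2 ⊆ D) : ¬ (α.1 ⊆ Bᶜ ∧ α.2 ⊆ Dᶜ) := by
  rintro ⟨h2, -⟩
  have hcard : 1 ≤ α.1.card := (Finset.mem_filter.mp hα).2.1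
  obtain ⟨a, ha⟩ := Finset.card_pos.mp hcard
  exact (Finset.mem_compl.mp (h2 ha)) (h1.1 ha)

/-- **The member at the glued point is the product of the two killed members.** -/
theorem anchoredWitness_glue (s h : ℕ) (B D : Finset (Fin h)) (θ₁ θ₂ : Finset (Fin h) × Finset (Fin h) → ℂ)
    (φ₁ ψ₁ φ₂ ψ₂ : Finset (Fin h) × Finset (Fin h) → Fin h → ℂ) :
    anchoredWitness s h (glueθ B D θ₁ θ₂) (glueφ B D φ₁ φ₂) (glueψ B D ψ₁ ψ₂) =
      kill (bvars B D) (anchoredWitness s h θ₁ φ₁ ψ₁) * kill (bvars Bᶜ Dᶜ) (anchoredWitness s h θ₂ φ₂ ψ₂) := by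
  rw [anchoredWitness_eq_prod_factor, anchoredWitness_eq_prod_factor, anchoredWitness_eq_prod_factor, map_prod, map_prod,
    ← Finset.prod_mul_distrib]
  refine Finset.prod_congr rfl (fun α hα => ?_)
  rw [kill_factor, kill_factor]
  by_cases h1 : α.1 ⊆ B ∧ α.2 ⊆ D
  · have h2 := not_both_blocks hα h1
    rw [if_pos h1, if_neg h2, mul_one, factor, factor]
    simp only [glueθ, glueφ, glueψ, if_pos h1]
  · rw [if_neg h1, one_mul]
    by_cases h2 : α.1 ⊆ Bᶜ ∧ α.2 ⊆ Dᶜ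
    · rw [if_pos h2, factor, factor]
      simp only [glueθ, glueφ, glueψ, if_neg h1, if_pos h2]
    · rw [if_neg h2, factor]
      simp only [glueθ, if_neg h1, if_neg h2, map_zero, zero_mul, add_zero]

/-! ## 4. The block-product theorem -/

/-- **Symbolic non-vanishing of 𝔄_s is closed under block products.** -/
theorem symbolicDet_blockProduct_ne_zero (s h : ℕ) (B D : Finset (Fin h)) {r r₁ r₂ : ℕ}
    (u w : Fin r → Finset (Fin h)) (u₁ w₁ : Fin r₁ → Finset (Fin h)) (u₂ w₂ : Fin r₂ → Finset (Fin h))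
    (hu₁ : ∀ i, u₁ i ⊆ B) (hw₁ : ∀ j, w₁ j ⊆ D) (hu₂ : ∀ i, u₂ i ⊆ Bᶜ) (hw₂ : ∀ j, w₂ j ⊆ Dᶜ)
    (er ec : Fin r ≃ Fin r₁ × Fin r₂) (hu : ∀ i, u i = u₁ (er i).1 ∪ u₂ (er i).2)
    (hw : ∀ j, w j = w₁ (ec j).1 ∪ w₂ (ec j).2)
    (h₁ : symbolicDet s h r₁ u₁ w₁ ≠ 0) (h₂ : symbolicDet s h r₂ u₂ w₂ ≠ 0) :
    symbolicDet s h r u w ≠ 0 := by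
  classical
  obtain ⟨θ₁, φ₁, ψ₁, hd₁⟩ := stub_genericPoint s h r₁ u₁ w₁ h₁
  obtain ⟨θ₂, φ₂, ψ₂, hd₂⟩ := stub_genericPoint s h r₂ u₂ w₂ h₂
  -- the glued point as a `Param h → ℂ`
  let p : Param h → ℂ
    | Sum.inl α => glueθ B D θ₁ θ₂ α
    | Sum.inr (Sum.inl (α, b)) => glueφ B D φ₁ φ₂ α b
    | Sum.inr (Sum.inr (α, d)) => glueψ B D ψ₁ ψ₂ α d
  refine symbolicDet_ne_zero_of_hit s h r u w p ?_
  have hp : anchoredWitness s h (fun α => p (Sum.inl α)) (fun α b => p (Sum.inr (Sum.inl (α, b))))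
      (fun α d => p (Sum.inr (Sum.inr (α, d)))) =
      kill (bvars B D) (anchoredWitness s h θ₁ φ₁ ψ₁) * kill (bvars Bᶜ Dᶜ) (anchoredWitness s h θ₂ φ₂ ψ₂) :=
    anchoredWitness_glue s h B D θ₁ θ₂ φ₁ ψ₁ φ₂ ψ₂
  rw [hp]
  set f₁ := kill (bvars B D) (anchoredWitness s h θ₁ φ₁ ψ₁) with hf₁
  set f₂ := kill (bvars Bᶜ Dᶜ) (anchoredWitness s h θ₂ φ₂ ψ₂) with hf₂
  -- the factor layouts of the killed members are those of the members
  have hdet₁ : (Matrix.of fun i j : Fin r₁ => coeff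
      (∑ a ∈ u₁ i, Finsupp.single (Fin.castAdd h a) 1 + ∑ c ∈ w₁ j, Finsupp.single (Fin.natAdd h c) 1) f₁).det ≠ 0 := by
    have hM : (Matrix.of fun i j : Fin r₁ => coeff
        (∑ a ∈ u₁ i, Finsupp.single (Fin.castAdd h a) 1 + ∑ c ∈ w₁ j, Finsupp.single (Fin.natAdd h c) 1) f₁) =
        Matrix.of fun i j : Fin r₁ => coeff
        (∑ a ∈ u₁ i, Finsupp.single (Fin.castAdd h a) 1 + ∑ c ∈ w₁ j, Finsupp.single (Fin.natAdd h c) 1)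
          (anchoredWitness s h θ₁ φ₁ ψ₁) := by
      ext i j
      rw [Matrix.of_apply, Matrix.of_apply, hf₁, coeff_kill, if_pos]
      exact (BlockProduct.support_partitionExpo_subset _ _).trans
        (Finset.union_subset_union (Finset.map_subset_map.mpr (hu₁ i)) (Finset.map_subset_map.mpr (hw₁ j)))
    rw [hM]; exact hd₁
  have hdet₂ : (Matrix.of fun i j : Fin r₂ => coeff
      (∑ a ∈ u₂ i, Finsupp.single (Fin.castAdd h a) 1 + ∑ c ∈ w₂ j, Finsupp.single (Fin.natAdd h c) 1) f₂).det ≠ 0 := by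
    have hM : (Matrix.of fun i j : Fin r₂ => coeff
        (∑ a ∈ u₂ i, Finsupp.single (Fin.castAdd h a) 1 + ∑ c ∈ w₂ j, Finsupp.single (Fin.natAdd h c) 1) f₂) =
        Matrix.of fun i j : Fin r₂ => coeff
        (∑ a ∈ u₂ i, Finsupp.single (Fin.castAdd h a) 1 + ∑ c ∈ w₂ j, Finsupp.single (Fin.natAdd h c) 1)
          (anchoredWitness s h θ₂ φ₂ ψ₂) := by
      ext i j
      rw [Matrix.of_apply, Matrix.of_apply, hf₂, coeff_kill, if_pos]
      exact (BlockProduct.support_partitionExpo_subset _ _).trans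
        (Finset.union_subset_union (Finset.map_subset_map.mpr (hu₂ i)) (Finset.map_subset_map.mpr (hw₂ j)))
    rw [hM]; exact hd₂
  exact (BlockProduct.partitionMinor_hit_of_blockProduct_fin B D u w u₁ w₁ u₂ w₂ hu₁ hw₁ hu₂ hw₂ er ec hu hw f₁ f₂
    (support_kill _ _) (support_kill _ _) hdet₁ hdet₂).2.2

end BlockGlue

end

end Summit.ValiantsHypothesis.ValiantsHypothesis.Theorems.BarrierLever.AnchoredPeeling
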